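import Mathlib
import Summits.Ventures.PercRepro2.CoincA3

/-!
# The coincidences `a₃ ∈ {a₁, a₂, o, b}`, II: the identities (blind cell PercRepro2, night-1 g9;
NIGHT1-G9.md §9)

`HMFc_a3_eq_b`: at `a₃ = b`, for every finite graph and every weight vector,
`HMFc = 4 B_H m₂ + 4 B_L m₁ + 2 B_N (m₁ + m₂)` in the nine-cell table of `(o, b)` under `Q`
(the masses of CoincA3 + the three-way splittings `StarO.prob_Q_split_o` + `ring`);
`HMFc_a3_eq_a1`, `HMFc_a3_eq_a2`, `HMFc_a3_eq_o`: the cleared mean field vanishes when `a₃` is a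
root (`PD = ∅`) or `o` (`D_o = 0`, `X̂ = 0`, `marginC = 0`), so (HMF) holds there outright
(`HMF_a3_eq_a1`, `HMF_a3_eq_a2`, `HMF_a3_eq_o`).
-/

namespace Summit.Ventures.PercRepro2

open UnionCluster CovForm

namespace Coinc
section Main

variable {V : Type*} {E : Type*} [Fintype E] [DecidableEq E] [Fintype V] [DecidableEq V]
  {R : Type*} [Field R] [LinearOrder R] [IsStrictOrderedRing R]

variable (p : E → R) (ends : E → Sym2 V) (o a₁ a₂ b : V)

omit [LinearOrder R] [IsStrictOrderedRing R] in
/-- **The cleared mean field at `a₃ = b`** (every graph, every weight vector):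
`HMFc = 4 B_H m₂ + 4 B_L m₁ + 2 B_N (m₁ + m₂)`. -/
theorem HMFc_a3_eq_b :
    HMFc p ends o a₁ a₂ b b =
      4 * prob p (avoidAll ends a₂ {a₁} ∩ connEvent ends a₂ b) *
          (prob p (avoidAll ends a₂ {a₁} ∩ connEvent ends a₂ o ∩ (connEvent ends a₁ b)ᶜ ∩
                (connEvent ends a₂ b)ᶜ) * prob p (avoidAll ends a₂ {a₁} ∩ connEvent ends a₁ b) -
            prob p (avoidAll ends a₂ {a₁} ∩ connEvent ends a₂ o ∩ connEvent ends a₁ b) *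
              prob p (avoidAll ends a₂ {a₁} ∩ (connEvent ends a₁ b)ᶜ ∩ (connEvent ends a₂ b)ᶜ)) +
        4 * prob p (avoidAll ends a₂ {a₁} ∩ connEvent ends a₁ b) *
          (prob p (avoidAll ends a₂ {a₁} ∩ connEvent ends a₁ o ∩ (connEvent ends a₁ b)ᶜ ∩
                (connEvent ends a₂ b)ᶜ) * prob p (avoidAll ends a₂ {a₁} ∩ connEvent ends a₂ b) -
            prob p (avoidAll ends a₂ {a₁} ∩ connEvent ends a₁ o ∩ connEvent ends a₂ b) *
              prob p (avoidAll ends a₂ {a₁} ∩ (connEvent ends a₁ b)ᶜ ∩ (connEvent ends a₂ b)ᶜ)) +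
        2 * prob p (avoidAll ends a₂ {a₁} ∩ (connEvent ends a₁ b)ᶜ ∩ (connEvent ends a₂ b)ᶜ) *
          ((prob p (avoidAll ends a₂ {a₁} ∩ connEvent ends a₁ o ∩ (connEvent ends a₁ b)ᶜ ∩
                (connEvent ends a₂ b)ᶜ) * prob p (avoidAll ends a₂ {a₁} ∩ connEvent ends a₂ b) -
            prob p (avoidAll ends a₂ {a₁} ∩ connEvent ends a₁ o ∩ connEvent ends a₂ b) *
              prob p (avoidAll ends a₂ {a₁} ∩ (connEvent ends a₁ b)ᶜ ∩ (connEvent ends a₂ b)ᶜ)) +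
           (prob p (avoidAll ends a₂ {a₁} ∩ connEvent ends a₂ o ∩ (connEvent ends a₁ b)ᶜ ∩
                (connEvent ends a₂ b)ᶜ) * prob p (avoidAll ends a₂ {a₁} ∩ connEvent ends a₁ b) -
            prob p (avoidAll ends a₂ {a₁} ∩ connEvent ends a₂ o ∩ connEvent ends a₁ b) *
              prob p (avoidAll ends a₂ {a₁} ∩ (connEvent ends a₁ b)ᶜ ∩ (connEvent ends a₂ b)ᶜ))) := by
  unfold HMFc CovForm.marginC CovForm.DEF CovForm.EQo CovForm.EQ3 CovForm.EQ3o CovForm.Do massM2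
    deltaT
  rw [PD_inter_bH, prob_empty, bH_inter_T, bL_inter_T, prob_empty, T_eq, T'_eq, gap_eq,
    Xhat_a3_eq_b, PD_eq]
  -- canonical cells `Q ∩ oX ∩ bY`
  have eLN : avoidAll ends a₂ {a₁} ∩ (connEvent ends a₁ b)ᶜ ∩ (connEvent ends a₂ b)ᶜ ∩
      connEvent ends a₁ o = avoidAll ends a₂ {a₁} ∩ connEvent ends a₁ o ∩ (connEvent ends a₁ b)ᶜ ∩
      (connEvent ends a₂ b)ᶜ := by
    ext ω; simp only [Set.mem_inter_iff]; tauto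
  have eHN : avoidAll ends a₂ {a₁} ∩ (connEvent ends a₁ b)ᶜ ∩ (connEvent ends a₂ b)ᶜ ∩
      connEvent ends a₂ o = avoidAll ends a₂ {a₁} ∩ connEvent ends a₂ o ∩ (connEvent ends a₁ b)ᶜ ∩
      (connEvent ends a₂ b)ᶜ := by
    ext ω; simp only [Set.mem_inter_iff]; tauto
  have eLL : avoidAll ends a₂ {a₁} ∩ connEvent ends a₁ b ∩ connEvent ends a₁ o =
      avoidAll ends a₂ {a₁} ∩ connEvent ends a₁ o ∩ connEvent ends a₁ b := Set.inter_right_comm _ _ _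
  have eHL : avoidAll ends a₂ {a₁} ∩ connEvent ends a₁ b ∩ connEvent ends a₂ o =
      avoidAll ends a₂ {a₁} ∩ connEvent ends a₂ o ∩ connEvent ends a₁ b := Set.inter_right_comm _ _ _
  have eLH : avoidAll ends a₂ {a₁} ∩ connEvent ends a₂ b ∩ connEvent ends a₁ o =
      avoidAll ends a₂ {a₁} ∩ connEvent ends a₁ o ∩ connEvent ends a₂ b := Set.inter_right_comm _ _ _
  have eHH : avoidAll ends a₂ {a₁} ∩ connEvent ends a₂ b ∩ connEvent ends a₂ o =
      avoidAll ends a₂ {a₁} ∩ connEvent ends a₂ o ∩ connEvent ends a₂ b := Set.inter_right_comm _ _ _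
  rw [eLN, eHN, eLL, eHL, eLH, eHH]
  -- the marginals through the nine cells
  have hZ := StarO.prob_Q_split_o (o := o) (a₁ := a₁) (a₂ := a₂) ends p Set.univ
  simp only [Set.inter_univ] at hZ
  have hBL := StarO.prob_Q_split_o (o := o) (a₁ := a₁) (a₂ := a₂) ends p (connEvent ends a₁ b)
  have hBH := StarO.prob_Q_split_o (o := o) (a₁ := a₁) (a₂ := a₂) ends p (connEvent ends a₂ b)
  have hBN := StarO.prob_Q_split_o (o := o) (a₁ := a₁) (a₂ := a₂) ends p
    ((connEvent ends a₁ b)ᶜ ∩ (connEvent ends a₂ b)ᶜ)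
  simp only [← Set.inter_assoc] at hBN
  have hAL := StarO.prob_Q_split_o (o := b) (a₁ := a₁) (a₂ := a₂) ends p (connEvent ends a₁ o)
  have hAH := StarO.prob_Q_split_o (o := b) (a₁ := a₁) (a₂ := a₂) ends p (connEvent ends a₂ o)
  have hAN := StarO.prob_Q_split_o (o := b) (a₁ := a₁) (a₂ := a₂) ends p
    ((connEvent ends o a₁)ᶜ ∩ (connEvent ends o a₂)ᶜ)
  have cN : ∀ X : Set (Config E), avoidAll ends a₂ {a₁} ∩ (connEvent ends b a₁)ᶜ ∩
      (connEvent ends b a₂)ᶜ ∩ X = avoidAll ends a₂ {a₁} ∩ X ∩ (connEvent ends a₁ b)ᶜ ∩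
      (connEvent ends a₂ b)ᶜ := by
    intro X
    rw [connEvent_comm ends b a₁, connEvent_comm ends b a₂]
    ext ω; simp only [Set.mem_inter_iff]; tauto
  have cL : ∀ X : Set (Config E), avoidAll ends a₂ {a₁} ∩ connEvent ends a₁ b ∩ X =
      avoidAll ends a₂ {a₁} ∩ X ∩ connEvent ends a₁ b := fun X => Set.inter_right_comm _ _ _
  have cH : ∀ X : Set (Config E), avoidAll ends a₂ {a₁} ∩ connEvent ends a₂ b ∩ X =
      avoidAll ends a₂ {a₁} ∩ X ∩ connEvent ends a₂ b := fun X => Set.inter_right_comm _ _ _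
  rw [cN, cL, cH] at hAL hAH hAN
  simp only [← Set.inter_assoc] at hAN
  rw [hZ, hAL, hAH, hAN, hBL, hBH, hBN]
  ring

end Main

section Trivial

variable {V : Type*} {E : Type*} [Fintype E] [DecidableEq E] [Fintype V] [DecidableEq V]
  {R : Type*} [Field R] [LinearOrder R] [IsStrictOrderedRing R]

variable (p : E → R) (ends : E → Sym2 V) (o a₁ a₂ b : V)

omit [Fintype E] [DecidableEq E] [Fintype V] [DecidableEq V] in
/-- `PD = ∅` when `a₃ = a₁`. -/
lemma PD_a1_eq_empty : PDEvent ends a₁ a₂ a₁ = ∅ := by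
  ext ω
  simp only [PDEvent, Dtilde, UnionCluster.inU, Set.mem_inter_iff, Set.mem_compl_iff,
    Set.mem_union, mem_connEvent, Set.mem_empty_iff_false, iff_false]
  rintro ⟨_, h⟩
  exact h (Or.inl (conn_refl ends ω a₁))

omit [Fintype E] [DecidableEq E] [Fintype V] [DecidableEq V] in
/-- `PD = ∅` when `a₃ = a₂`. -/
lemma PD_a2_eq_empty : PDEvent ends a₁ a₂ a₂ = ∅ := by
  ext ω
  simp only [PDEvent, Dtilde, UnionCluster.inU, Set.mem_inter_iff, Set.mem_compl_iff,
    Set.mem_union, mem_connEvent, Set.mem_empty_iff_false, iff_false]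
  rintro ⟨_, h⟩
  exact h (Or.inr (conn_refl ends ω a₂))

omit [LinearOrder R] [IsStrictOrderedRing R] in
/-- **`HMFc = 0` when `a₃ = a₁`.** -/
theorem HMFc_a3_eq_a1 : HMFc p ends o a₁ a₂ a₁ b = 0 := by
  unfold HMFc CovForm.marginC CovForm.DEF CovForm.Do
  rw [PD_a1_eq_empty]
  simp only [Set.empty_inter, prob_empty]
  ring

omit [LinearOrder R] [IsStrictOrderedRing R] in
/-- **`HMFc = 0` when `a₃ = a₂`.** -/
theorem HMFc_a3_eq_a2 : HMFc p ends o a₁ a₂ a₂ b = 0 := by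
  unfold HMFc CovForm.marginC CovForm.DEF CovForm.Do
  rw [PD_a2_eq_empty]
  simp only [Set.empty_inter, prob_empty]
  ring

omit [Fintype E] [DecidableEq E] [Fintype V] [DecidableEq V] in
/-- `PD ∩ {o ∈ C₁} = ∅` when `a₃ = o`. -/
lemma PD_o_inter_oL : PDEvent ends a₁ a₂ o ∩ connEvent ends a₁ o = ∅ := by
  ext ω
  simp only [PDEvent, Dtilde, UnionCluster.inU, Set.mem_inter_iff, Set.mem_compl_iff,
    Set.mem_union, mem_connEvent, Set.mem_empty_iff_false, iff_false]
  rintro ⟨⟨_, h⟩, h'⟩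
  exact h (Or.inl (conn_symm h'))

omit [Fintype E] [DecidableEq E] [Fintype V] [DecidableEq V] in
/-- `PD ∩ {o ∈ C₂} = ∅` when `a₃ = o`. -/
lemma PD_o_inter_oH : PDEvent ends a₁ a₂ o ∩ connEvent ends a₂ o = ∅ := by
  ext ω
  simp only [PDEvent, Dtilde, UnionCluster.inU, Set.mem_inter_iff, Set.mem_compl_iff,
    Set.mem_union, mem_connEvent, Set.mem_empty_iff_false, iff_false]
  rintro ⟨⟨_, h⟩, h'⟩
  exact h (Or.inr (conn_symm h'))

omit [Fintype E] [DecidableEq E] [Fintype V] [DecidableEq V] in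
/-- `T ∩ {o ∈ C₁} = ∅`, `T ∩ {o ∈ C₂} = T` when `a₃ = o`. -/
lemma T_o_inter : TEvent ends a₁ a₂ o ∩ connEvent ends a₁ o = ∅ ∧
    TEvent ends a₁ a₂ o ∩ connEvent ends a₂ o = TEvent ends a₁ a₂ o := by
  constructor
  · ext ω
    simp only [TEvent, Set.mem_inter_iff, Set.mem_compl_iff, mem_connEvent,
      Set.mem_empty_iff_false, iff_false, not_and]
    rintro ⟨hQ, h2⟩ h1
    exact hQ (conn_trans h2 (conn_symm h1))
  · ext ω
    simp only [TEvent, Set.mem_inter_iff, Set.mem_compl_iff, mem_connEvent]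
    tauto

omit [Fintype E] [DecidableEq E] [Fintype V] [DecidableEq V] in
/-- `T′ ∩ {o ∈ C₂} = ∅`, `T′ ∩ {o ∈ C₁} = T′` when `a₃ = o`. -/
lemma T'_o_inter : TEvent ends a₂ a₁ o ∩ connEvent ends a₂ o = ∅ ∧
    TEvent ends a₂ a₁ o ∩ connEvent ends a₁ o = TEvent ends a₂ a₁ o := by
  constructor
  · ext ω
    simp only [TEvent, Set.mem_inter_iff, Set.mem_compl_iff, mem_connEvent,
      Set.mem_empty_iff_false, iff_false, not_and]
    rintro ⟨hQ, h1⟩ h2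
    exact hQ (conn_trans h1 (conn_symm h2))
  · ext ω
    simp only [TEvent, Set.mem_inter_iff, Set.mem_compl_iff, mem_connEvent]
    tauto

omit [Fintype E] [DecidableEq E] [Fintype V] [DecidableEq V] in
/-- `T = Q ∩ {o ∈ C₂}`, `T′ = Q ∩ {o ∈ C₁}` when `a₃ = o`. -/
lemma T_o_eq : TEvent ends a₁ a₂ o = avoidAll ends a₂ {a₁} ∩ connEvent ends a₂ o ∧
    TEvent ends a₂ a₁ o = avoidAll ends a₂ {a₁} ∩ connEvent ends a₁ o := by
  constructor
  · ext ω
    simp only [TEvent, Set.mem_inter_iff, Set.mem_compl_iff, mem_connEvent,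
      PendantRoot.avoidAll_eq_compl]
    constructor
    · rintro ⟨hQ, h⟩; exact ⟨fun h' => hQ (conn_symm h'), h⟩
    · rintro ⟨hQ, h⟩; exact ⟨fun h' => hQ (conn_symm h'), h⟩
  · ext ω
    simp only [TEvent, Set.mem_inter_iff, Set.mem_compl_iff, mem_connEvent,
      PendantRoot.avoidAll_eq_compl]

omit [LinearOrder R] [IsStrictOrderedRing R] in
/-- The mean field vanishes when `a₃ = o`: every row contains `o`, and every term carries the
factor `P_{G∖W}(· ↔ o) = 0`. -/
lemma Xhat_a3_eq_o : Xhat p ends o a₁ a₂ o b = 0 := by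
  rw [Xhat_eq_sum]
  refine Finset.sum_eq_zero fun W _ => ?_
  by_cases ho : o ∈ W
  · rw [mul_eq_zero]; right
    simp only [termW, termT, termPD, delConnProb, delShareMass, if_pos ho, zero_mul, zero_add,
      zero_div]
    split_ifs <;> rfl
  · rw [clusterEvent_b_eq_empty ends o ho, prob_empty, zero_mul]

omit [LinearOrder R] [IsStrictOrderedRing R] in
/-- **`HMFc = 0` when `a₃ = o`.** -/
theorem HMFc_a3_eq_o : HMFc p ends o a₁ a₂ o b = 0 := by
  unfold HMFc CovForm.marginC CovForm.DEF CovForm.Do CovForm.EQo CovForm.EQ3o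
  rw [PD_o_inter_oL, PD_o_inter_oH, Xhat_a3_eq_o, (T_o_inter ends o a₁ a₂).1,
    (T_o_inter ends o a₁ a₂).2, (T'_o_inter ends o a₁ a₂).1, (T'_o_inter ends o a₁ a₂).2,
    (T_o_eq ends o a₁ a₂).1, (T_o_eq ends o a₁ a₂).2]
  simp only [prob_empty]
  ring

omit [IsStrictOrderedRing R] in
/-- **(HMF) holds when `a₃` coincides with `a₁`, `a₂` or `o`** (the cleared mean field vanishes). -/
theorem HMF_a3_eq_a1 : HMF p ends o a₁ a₂ a₁ b := by
  unfold HMF; rw [HMFc_a3_eq_a1]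

omit [IsStrictOrderedRing R] in
/-- **(HMF) holds when `a₃ = a₂`.** -/
theorem HMF_a3_eq_a2 : HMF p ends o a₁ a₂ a₂ b := by
  unfold HMF; rw [HMFc_a3_eq_a2]

omit [IsStrictOrderedRing R] in
/-- **(HMF) holds when `a₃ = o`.** -/
theorem HMF_a3_eq_o : HMF p ends o a₁ a₂ o b := by
  unfold HMF; rw [HMFc_a3_eq_o]

end Trivial

end Coinc

end Summit.Ventures.PercRepro2
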